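import Literature.Computability.AlgebraicComplexity.StandardFamilies
import HarnessLib

/-!
# The generic determinant has total degree `n`: discharge of `totalDegree_detPoly`
# (and, appended: the Hamiltonian cycle family is a p-family, `isPFamily_hcPoly_holds`)

D-0014 keeps `Literature/` sorry-free by stating cited results as named facts `def X : Prop`.
This sibling file of `Literature.Computability.AlgebraicComplexity.StandardFamilies` proves the
named fact `totalDegree_detPoly` stated there:

* `totalDegree_detPoly_holds`: over a nontrivial commutative ring `k` the generic determinant
  `DET_n = det (X_{ij})` (`detPoly n k`, Bürgisser 2000, §2.1, (2.1)) has total degree `card n`.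
* `isPFamily_hcPoly_holds` (appended 2026-08-15): the Hamiltonian cycle family `(HC_n)_n`,
  `HC_n = ∑_{σ an n-cycle} ∏ᵢ X_{σ i, i}` (`hcPoly (Fin n) k`, Bürgisser 2000, §2.1, (2.3);
  Bürgisser–Clausen–Shokrollahi 1997, p. 547 and Prop. (21.15)) is a p-family in the sense of
  Bürgisser 2000, Def. 2.3 / BCS 1997, Def. (21.2)(1): `n²` variables and `deg HC_n ≤ n`
  (by homogeneity, `hcPoly_isHomogeneous`), both p-bounded — the same two-line argument as the
  tree's `isPFamily_perPoly_holds` and `isPFamily_detPoly_holds`.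

## The printed statement and the proof formalised

Bürgisser 2000, §2.1 introduces `DET_n = det [X_{ij}]_{1 ≤ i,j ≤ n}` ((2.1)) as a p-family: `n²`
variables, degree `n`; likewise Bürgisser–Clausen–Shokrollahi 1997, Chap. 1 (Introduction, the display
`DET_n := ∑_{σ ∈ S_n} sgn(σ) ∏ᵢ X_{iσ(i)}` preceding Sect. 1.1) and Example (21.6)(4)
(`DET := (DET_n)_{n ≥ 1}`, `DET_n := det (X_{ij})`, is a p-family in `VP`). The degree statement is recorded there without proof; the one-line reason,
formalised here, is: `DET_n` is a form of degree `n` (each of the `n!` signed monomials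
`∏ᵢ X_{π i, i}` has degree `n`; in Lean `detPoly_isHomogeneous` of `StandardFamilies.lean`), it is
not the zero polynomial because it evaluates to `det 1 = 1 ≠ 0` at the identity matrix — this is
where `Nontrivial k` enters (Mathlib's `Matrix.det_mvPolynomialX_ne_zero`) — and a nonzero
homogeneous polynomial of degree `d` has total degree exactly `d`
(`MvPolynomial.IsHomogeneous.totalDegree`). Over the zero ring `detPoly n k = 0` has total
degree `0`, which is why the named fact carries the hypothesis `Nontrivial k`.

## Design notes

* No new definitions; the statement of `totalDegree_detPoly` is used verbatim (its implicit
  `n`, `k` are passed by name).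
* Imports: `StandardFamilies` (the fact, `detPoly`, `detPoly_isHomogeneous`; it already imports
  `Mathlib.LinearAlgebra.Matrix.MvPolynomial` and `Mathlib.RingTheory.MvPolynomial.Homogeneous`).

## References

* P. Bürgisser, *Completeness and Reduction in Algebraic Complexity Theory*, Algorithms and
  Computation in Mathematics 7, Springer 2000, §2.1, eq. (2.1) (the determinant family).
* P. Bürgisser, M. Clausen, M. A. Shokrollahi, *Algebraic Complexity Theory*, Grundlehren 315,
  Springer 1997, Chap. 1 (display defining `DET_n`, `PER_n`, before Sect. 1.1), Example (21.6)(4)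
  (Chap. 21, Sect. 21.1); Def. (21.2)(1) (p-family, p. 545), the display defining `HC_n` (p. 547)
  and Prop. (21.15) (`PER, HC ∈ VNP`, p. 548).
-/

noncomputable section

open MvPolynomial

namespace Literature.Computability.AlgebraicComplexity

/-- **Discharge** of the named fact `totalDegree_detPoly`: over a nontrivial commutative ring the
generic determinant `DET_n = det (X_{ij}) = ∑_π sgn π ∏ᵢ X_{π i, i}` has total degree `card n`
(Bürgisser 2000, §2.1, (2.1): `DET_n` has degree `n` in the `n²` variables `X_{ij}`;
Bürgisser–Clausen–Shokrollahi 1997, Chap. 1 and Example (21.6)(4)). Proof: `DET_n` is a form of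
degree `card n` (`detPoly_isHomogeneous`), nonzero since it evaluates to `det 1 = 1 ≠ 0`
(`Matrix.det_mvPolynomialX_ne_zero`, using `Nontrivial k`), and a nonzero homogeneous polynomial
of degree `d` has total degree `d` (`MvPolynomial.IsHomogeneous.totalDegree`).
[cite: Burgisser2000, §2.1] -/
theorem totalDegree_detPoly_holds {n : Type*} [Fintype n] [DecidableEq n] {k : Type*} :
    totalDegree_detPoly (n := n) (k := k) := by
  intro _ _
  exact detPoly_isHomogeneous.totalDegree (Matrix.det_mvPolynomialX_ne_zero n k)

/-- **Discharge** of the named fact `isPFamily_hcPoly`: the Hamiltonian cycle family `(HC_n)_n`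
over `Fin n` is a p-family — `n²` variables (`card (Fin n × Fin n) = n² ≤ (n+1)²`) and total
degree `≤ n` by homogeneity (`hcPoly_isHomogeneous.totalDegree_le`), exactly as for `PER` and
`DET` (`isPFamily_perPoly_holds`, `isPFamily_detPoly_holds`). Sources: Bürgisser 2000, §2.1,
Def. 2.3 and eq. (2.3); Bürgisser–Clausen–Shokrollahi 1997, Def. (21.2)(1) (p-family: `n ↦ v(fₙ)`
and `n ↦ deg fₙ` p-bounded), p. 547 (definition of `HC_n`) and Prop. (21.15) (`HC ∈ VNP`, in
particular a p-family). [cite: Burgisser2000, §2.1]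
[cite: BurgisserClausenShokrollahi1997, Def. (21.2)(1)] -/
theorem isPFamily_hcPoly_holds {k : Type*} : isPFamily_hcPoly (k := k) := by
  intro _
  refine ⟨(IsPBounded.iff_exists_le_mul_succ_pow _).2 ⟨1, 2, fun m => ?_⟩,
    (IsPBounded.iff_exists_le_mul_succ_pow _).2 ⟨1, 1, fun m => ?_⟩⟩
  · have h : 1 * (m + 1) ^ 2 = m * m + 2 * m + 1 := by ring
    simp only [Fintype.card_prod, Fintype.card_fin]
    omega
  · dsimp only
    calc (hcPoly (Fin m) k).totalDegree ≤ Fintype.card (Fin m) :=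
          hcPoly_isHomogeneous.totalDegree_le
      _ ≤ 1 * (m + 1) ^ 1 := by simp


/-! ## Appendix (2026-08-15): the generic permanent has total degree `n` -/

/-- The generic permanent is not the zero polynomial over a nontrivial commutative semiring: it
evaluates to `per 1 = 1` at the identity matrix (Bürgisser 2000, §2.1, (2.2); cf. Mathlib's
`Matrix.det_mvPolynomialX_ne_zero` for the determinant). [cite: Burgisser2000, §2.1] -/
theorem perPoly_ne_zero (n : Type*) [Fintype n] [DecidableEq n] (k : Type*) [CommSemiring k]
    [Nontrivial k] : perPoly n k ≠ 0 := by
  intro h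
  have h1 := eval_perPoly (n := n) (k := k) (fun p => if p.1 = p.2 then 1 else 0)
  rw [h, map_zero] at h1
  have h2 : (Matrix.of fun i j : n => if i = j then (1 : k) else 0) = 1 := by
    ext i j
    simp [Matrix.one_apply]
  rw [h2, Matrix.permanent_one] at h1
  exact zero_ne_one h1

/-- **Discharge** of the named fact `totalDegree_perPoly`: over a nontrivial commutative semiring
the generic permanent `PER_n = per (X_{ij}) = ∑_π ∏ᵢ X_{π i, i}` has total degree `card n`
(Bürgisser 2000, §2.1, (2.2): `PER_n` has degree `n` in the `n²` variables `X_{ij}`;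
Bürgisser–Clausen–Shokrollahi 1997, Chap. 1). Proof: `PER_n` is a form of degree `card n`
(`perPoly_isHomogeneous`), nonzero since it evaluates to `per 1 = 1 ≠ 0` (`perPoly_ne_zero`,
using `Nontrivial k`), and a nonzero homogeneous polynomial of degree `d` has total degree `d`
(`MvPolynomial.IsHomogeneous.totalDegree`). [cite: Burgisser2000, §2.1] -/
theorem totalDegree_perPoly_holds {n : Type*} [Fintype n] [DecidableEq n] {k : Type*} :
    totalDegree_perPoly (n := n) (k := k) := by
  intro _ _
  exact perPoly_isHomogeneous.totalDegree (perPoly_ne_zero n k)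

end Literature.Computability.AlgebraicComplexity

end
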